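import Summits.QuantumFields.BalabanUV.T4Continuum.Spine.NE2.OneStepRemainderDomination

/-!
# T⁴ programme, spine node NE2 (U1a) — R14 W3a, file 3: THE ONE-STEP PROLONGATION DEFECT — `√(L^d)·Q₁(1)·J − 1` is an average of directional shift defects, hence small against `Δ_a⁻¹`
# (King's mechanism at one step; cell `pub-balaban-gaps`, seat ne2 gen 5; plan `ne/NE2-R14-PLAN.md` STATUS v5 ADDENDUM (ii); imports only W3 file 2)

The SAME-DATA half of the sandwiched two-level fields of the composed remainder (`Erem_succ`: `E″_{k+1}(J⊗1) − E″_k = E″_k(√(L^d)Q^{main}_k(J⊗1) − 1) + √(L^d)(B+E+E″)_kQ″_k(J⊗1)`) needs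
`‖(√(L^d)Q₁(S)(J⊗1) − 1)(Δ_{a,k}⊗1)⁻¹‖ = O(L^{−k})`.  Its free part is THIS FILE: with King's isometric prolongation `J = JK` (`KingPairingPlantedLaw`) and the scalar one-step (1.18) averaging
**`QstepFree`** (`Qstep 1 = QstepFree ⊗ 1`, `Qstep_one`),
 * **`sqrt_smul_QstepFree_mul_JK`**: `√(L^d)·Q₁·J = L^{−(d+1)} Σ_{r∈[0,L)^d} Σ_{s<L} D_{r,s}`, where `D_{r,s}` is the identity on the rows `(x, μ)` with `r_μ + s < L` and the DIRECTIONAL SHIFT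
   **`dshift`** (`(Df)(x, μ) = f(x + e_μ, μ)`) on the others (a line of length `L` from offset `r` reads the parent `x` for `L − r_μ` positions and `x + e_μ` for `r_μ` positions) — EXACT;
 * `dshift_sub_one_eq`: `D − 1 = Σ_ν P_ν(S^ν − 1)` (`P_ν` the component projector, `S^ν` = `B5Prop11Plancherel.shiftM`), hence **`opNorm_dshift_sub_one_mul_le`**: `‖(D − 1)X‖ ≤ Σ_ν ‖(S^ν − 1)X‖`;
 * **`opNorm_sqrt_QstepFree_JK_sub_one_mul_le`**: `‖(√(L^d)Q₁J − 1)X‖ ≤ Σ_ν ‖(S^ν − 1)X‖` for ANY `X`, and with [B5] (1.89)'s axis defects (`opNorm_fdiff_calG_le`, `opNorm_shiftM_sub_one_mul_le`)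
   **`opNorm_prolongation_defect_calG_le`**: `‖(√(L^d)·Q₁(1)·(J_k⊗1) − 1)·(Δ_{a,k}⊗1)⁻¹‖ ≤ d·Cst·L^{−k}` along the tower (`n_k = L^k`).
NOT here: the transport part `√(L^d)(Q₁(S) − Q₁(1))(J⊗1)(Δ⊗1)⁻¹` (`= O(σ_k)` by `OneStepRemainderLipschitz.opNorm_Qstep_sub_Qstep_le`) and the assembly of hRem₂/hRem₃ (successor).
HONEST FRAMING (T4-DAG p. 1).  Free-lattice bookkeeping (U = 1 objects only); NOT NE2; **NE2 (U1a) NOT PROVED**; spine PROVED 0/9 unchanged; NOT continuum YM / infinite volume / mass gap / Clay.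
No `sorry`.
-/

noncomputable section

open scoped BigOperators ComplexConjugate Matrix Matrix.Norms.L2Operator Kronecker

namespace Summit.QuantumFields.BalabanUV.T4Continuum.NE2.OneStepProlongationDefect

open Literature.MathematicalPhysics.QuantumFieldTheory.Balaban1983to89.B5Prop11Plancherel (Tor fine unitVec shiftM fdiff Cst Cst_nonneg calG opNorm_fdiff_calG_le)
open Literature.MathematicalPhysics.QuantumFieldTheory.Balaban1983to89.B5Block118 (tstep)
open Literature.MathematicalPhysics.QuantumFieldTheory.Balaban1983to89.B5Composition116 (tstep_add)
open Literature.MathematicalPhysics.QuantumFieldTheory.Balaban1983to89.B5G183RateTorus (cpt)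
open Literature.MathematicalPhysics.QuantumFieldTheory.Balaban1983to89.B5G183RateTorusW (off Qavg)
open Literature.MathematicalPhysics.QuantumFieldTheory.Balaban1983to89.B5G183RateUnitTower (lev lev_neZero)
open Summit.QuantumFields.BalabanUV.T4Continuum
open Summit.QuantumFields.BalabanUV.T4Continuum.BalabanAveragedTowerUnit (idx calGlev one_le_lev' cast_lev')
open Summit.QuantumFields.BalabanUV.T4Continuum.BalabanAveragedTowerModes (par rem cpt_par_add_off_rem par_cpt_add_off rem_cpt_add_off)
open Summit.QuantumFields.BalabanUV.T4Continuum.ScalarMassTower (cpt_add_unitVec)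
open Summit.QuantumFields.BalabanUV.T4Continuum.LineAveragingTwoLevel (off_update)
open Summit.QuantumFields.BalabanUV.T4Continuum.KingPairingPlantedLaw (JK JpcT JpcT_eq_JK calDalev calDalev_inv)
open Summit.QuantumFields.BalabanUV.T4Continuum.BalabanBlockPoincare (opNorm_shiftM_sub_one_mul_le)
open Summit.QuantumFields.BalabanUV.T4Continuum.KroneckerLift (kron_mul kron_inv opNorm_kron_le_of_le sub_kronecker)
open Summit.QuantumFields.BalabanUV.T4Continuum.NE2.ComposedAveragingIdentity (Qstep)
open Summit.QuantumFields.BalabanUV.T4Continuum.NE2.OneStepRemainder (line_pt_eq)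

variable {d : ℕ}

/-! ## §1 The scalar one-step averaging and the directional shift -/

section Step

variable (n L : ℕ) [NeZero n] [NeZero L] (M : Fin d → ℕ) [hM : ∀ μ, NeZero (M μ)] {o : Type*} [Fintype o] [DecidableEq o]

/-- the SCALAR one-step (1.18) averaging between adjacent levels `n → L·n` (the table-free `Qstep`). [cite: Balaban1984PropagatorsI, (1.18) p.20 (shape)] [folklore] -/
def QstepFree : Matrix (Tor (fine n M) × Fin d) (Tor (fine (L * n) M) × Fin d) ℂ :=
  fun b i => if i.2 = b.2 then ∑ r : Fin d → Fin L, ∑ s : Fin L,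
      (if i.1 = cpt n L M b.1 + off n L M r + tstep (fine (L * n) M) b.2 (s : ℕ) then (1 / (L : ℂ) ^ (d + 1)) else 0)
    else 0

omit [NeZero n] [NeZero L] hM [Fintype o] in
/-- `Q₁(1) = QstepFree ⊗ 1`. [folklore] -/
theorem Qstep_one : Qstep n L M (fun _ _ _ _ => (1 : Matrix o o ℂ)) = QstepFree n L M ⊗ₖ (1 : Matrix o o ℂ) := by
  ext ⟨b, α⟩ ⟨i, α'⟩
  simp only [Qstep, QstepFree, Matrix.kroneckerMap_apply]
  by_cases h : i.2 = b.2
  · rw [if_pos h, if_pos h, Finset.sum_mul]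
    refine Finset.sum_congr rfl fun r _ => ?_
    rw [Finset.sum_mul]
    refine Finset.sum_congr rfl fun s _ => ?_
    split_ifs <;> simp
  · rw [if_neg h, if_neg h, zero_mul]

/-- the DIRECTIONAL SHIFT on bond fields of a torus: `(Df)(x, μ) = f(x + e_μ, μ)`. [folklore] -/
def dshift (N : Fin d → ℕ) : Matrix (Tor N × Fin d) (Tor N × Fin d) ℂ :=
  fun b i => if i = (b.1 + unitVec N b.2, b.2) then 1 else 0

/-- the component projector `P_ν`. [folklore] -/
def Pcomp (N : Fin d → ℕ) (ν : Fin d) : Matrix (Tor N × Fin d) (Tor N × Fin d) ℂ :=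
  Matrix.diagonal fun b => if b.2 = ν then 1 else 0

omit hM in
/-- `D − 1 = Σ_ν P_ν(S^ν − 1)`. [folklore] -/
theorem dshift_sub_one_eq (N : Fin d → ℕ) [∀ μ, NeZero (N μ)] :
    dshift N - 1 = ∑ ν : Fin d, Pcomp N ν * (shiftM N ν - 1) := by
  ext b i
  rw [Matrix.sum_apply, Finset.sum_eq_single b.2]
  · simp only [Pcomp, Matrix.diagonal_mul, if_true, one_mul, Matrix.sub_apply, dshift, shiftM]
  · intro ν _ hν
    simp only [Pcomp, Matrix.diagonal_mul, if_neg (Ne.symm hν), zero_mul]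
  · intro h; exact absurd (Finset.mem_univ _) h

omit hM in
/-- `‖P_ν‖ ≤ 1`. [folklore] -/
theorem opNorm_Pcomp_le (N : Fin d → ℕ) [∀ μ, NeZero (N μ)] (ν : Fin d) : ‖Pcomp N ν‖ ≤ 1 := by
  rw [Pcomp, Matrix.l2_opNorm_diagonal]
  refine (pi_norm_le_iff_of_nonneg zero_le_one).mpr fun b => ?_
  split_ifs <;> simp

omit hM in
/-- **`‖(D − 1)X‖ ≤ Σ_ν ‖(S^ν − 1)X‖`**. [folklore] -/
theorem opNorm_dshift_sub_one_mul_le (N : Fin d → ℕ) [∀ μ, NeZero (N μ)] {β : Type*} [Fintype β] [DecidableEq β] (X : Matrix (Tor N × Fin d) β ℂ) :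
    ‖(dshift N - 1) * X‖ ≤ ∑ ν : Fin d, ‖(shiftM N ν - 1) * X‖ := by
  rw [dshift_sub_one_eq, Matrix.sum_mul]
  refine (norm_sum_le _ _).trans (Finset.sum_le_sum fun ν _ => ?_)
  rw [Matrix.mul_assoc]
  calc ‖Pcomp N ν * ((shiftM N ν - 1) * X)‖ ≤ ‖Pcomp N ν‖ * ‖(shiftM N ν - 1) * X‖ := Matrix.l2_opNorm_mul _ _
    _ ≤ 1 * ‖(shiftM N ν - 1) * X‖ := mul_le_mul_of_nonneg_right (opNorm_Pcomp_le N ν) (norm_nonneg _)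
    _ = _ := one_mul _

/-! ## §2 The exact form of `√(L^d)·Q₁·J` -/

/-- the LINE-POSITION MATRIX of the pair `(r, s)`: identity on the rows `(x, μ)` with `r_μ + s < L`, the directional shift on the others. [folklore] -/
def lineInd (r : Fin d → Fin L) (s : Fin L) : Matrix (Tor (fine n M) × Fin d) (Tor (fine n M) × Fin d) ℂ :=
  fun b i => if (r b.2 : ℕ) + (s : ℕ) < L then (if i = b then 1 else 0) else (if i = (b.1 + unitVec (fine n M) b.2, b.2) then 1 else 0)

omit [NeZero n] [NeZero L] hM in
/-- the entries of `Q_R` are real: `star (Q_R i z) = Q_R i z`. [folklore] -/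
theorem star_Qavg_apply (i : Tor (fine n M) × Fin d) (z : Tor (fine (L * n) M) × Fin d) : star (Qavg n L M i z) = Qavg n L M i z := by
  simp only [Qavg, Complex.star_def, map_mul, map_inv₀, map_pow, map_natCast, map_sum]
  congr 1
  refine Finset.sum_congr rfl fun j _ => ?_
  split_ifs <;> simp

/-- block membership as a `ℂ`-valued indicator: `Σ_j [z = (L·x′ + j, μ′)] = [par z = x′ ∧ z₂ = μ′]`. [folklore] -/
theorem sum_ite_block_eq (x' : Tor (fine n M)) (μ' : Fin d) (z : Tor (fine (L * n) M) × Fin d) :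
    (∑ j : Fin d → Fin L, (if z = (cpt n L M x' + off n L M j, μ') then (1 : ℂ) else 0))
      = if par n L M z.1 = x' ∧ z.2 = μ' then 1 else 0 := by
  by_cases h : par n L M z.1 = x' ∧ z.2 = μ'
  · rw [if_pos h, Finset.sum_eq_single (rem n L M z.1)]
    · rw [if_pos]; exact Prod.ext (by rw [← h.1, cpt_par_add_off_rem]) h.2
    · intro j _ hj
      rw [if_neg]
      intro hz
      apply hj
      have h' := rem_cpt_add_off n L M x' j
      rw [← show z.1 = cpt n L M x' + off n L M j from congrArg Prod.fst hz] at h'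
      exact h'.symm
    · intro h'; exact absurd (Finset.mem_univ _) h'
  · rw [if_neg h]
    refine Finset.sum_eq_zero fun j _ => ?_
    rw [if_neg]
    intro hz
    apply h
    refine ⟨?_, congrArg Prod.snd hz⟩
    rw [show z.1 = cpt n L M x' + off n L M j from congrArg Prod.fst hz, par_cpt_add_off]

/-- the block parent of a line point: `par(L·x + r + s e_μ) = x` if `r_μ + s < L`, `= x + e_μ` otherwise (`s < L`). [folklore] -/
theorem par_line_pt (x : Tor (fine n M)) (r : Fin d → Fin L) (μ : Fin d) (s : Fin L) :
    par n L M (cpt n L M x + off n L M r + tstep (fine (L * n) M) μ (s : ℕ)) = if (r μ : ℕ) + (s : ℕ) < L then x else x + unitVec (fine n M) μ := by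
  rw [line_pt_eq]
  split_ifs with h
  · rw [add_assoc, ← off_update n L M r μ ⟨(r μ : ℕ) + (s : ℕ), h⟩, par_cpt_add_off]
  · rw [not_lt] at h
    obtain ⟨q, hq, hqs⟩ : ∃ q : ℕ, q < L ∧ (r μ : ℕ) + (s : ℕ) = L + q :=
      ⟨(r μ : ℕ) + (s : ℕ) - L, by have := (r μ).isLt; have := s.isLt; omega, by omega⟩
    rw [hqs, tstep_add, ← add_assoc, add_right_comm (cpt n L M x), ← cpt_add_unitVec, add_assoc, ← off_update n L M r μ ⟨q, hq⟩, par_cpt_add_off]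

/-- **THE EXACT FORM**: `√(L^d)·Q₁·J = L^{−(d+1)}·Σ_{r} Σ_{s<L} D_{r,s}`. [folklore] -/
theorem sqrt_smul_QstepFree_mul_JK :
    (((Real.sqrt ((L : ℝ) ^ d)) : ℝ) : ℂ) • (QstepFree n L M * JK n L M)
      = (1 / (L : ℂ) ^ (d + 1)) • ∑ r : Fin d → Fin L, ∑ s : Fin L, lineInd n L M r s := by
  have hLc : ((L : ℂ) ^ d) ≠ 0 := pow_ne_zero _ (by exact_mod_cast NeZero.ne L)
  obtain ⟨_, hss⟩ := KingPairingPlantedLaw.sqrt_facts (d := d) L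
  set sq : ℂ := (((Real.sqrt ((L : ℝ) ^ d)) : ℝ) : ℂ) with hsq
  set w : ℂ := 1 / (L : ℂ) ^ (d + 1) with hw
  ext b i
  -- the indicator read by `J`
  set ind : Tor (fine (L * n) M) × Fin d → ℂ := fun z => if par n L M z.1 = i.1 ∧ z.2 = i.2 then 1 else 0 with hind
  have hJ : ∀ z : Tor (fine (L * n) M) × Fin d, JK n L M z i = sq * (((L : ℂ) ^ d)⁻¹ * ind z) := by
    intro z
    rw [JK, Matrix.smul_apply, Matrix.conjTranspose_apply, star_Qavg_apply, smul_eq_mul, hind]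
    simp only [Qavg]
    rw [sum_ite_block_eq]
  -- the line sums of `QstepFree`
  set A : Tor (fine (L * n) M) → ℂ := fun z1 => ∑ r : Fin d → Fin L, ∑ s : Fin L,
    (if z1 = cpt n L M b.1 + off n L M r + tstep (fine (L * n) M) b.2 (s : ℕ) then w else 0) with hA
  have hQ : ∀ z : Tor (fine (L * n) M) × Fin d, QstepFree n L M b z = if z.2 = b.2 then A z.1 else 0 := fun z => rfl
  -- Step C: collapse the sum over the fine bond
  have hC : ∑ z : Tor (fine (L * n) M) × Fin d, QstepFree n L M b z * ind z
      = ∑ r : Fin d → Fin L, ∑ s : Fin L, w * ind (cpt n L M b.1 + off n L M r + tstep (fine (L * n) M) b.2 (s : ℕ), b.2) := by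
    simp_rw [hQ]
    rw [Fintype.sum_prod_type]
    have h2 : ∀ z1 : Tor (fine (L * n) M), ∑ z2 : Fin d, (if z2 = b.2 then A z1 else 0) * ind (z1, z2) = A z1 * ind (z1, b.2) := by
      intro z1
      simp_rw [ite_mul, zero_mul]
      rw [Finset.sum_ite_eq', if_pos (Finset.mem_univ _)]
    simp_rw [h2, hA, Finset.sum_mul]
    rw [Finset.sum_comm]
    refine Finset.sum_congr rfl fun r _ => ?_
    rw [Finset.sum_comm]
    refine Finset.sum_congr rfl fun s _ => ?_
    simp_rw [ite_mul, zero_mul]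
    rw [Finset.sum_ite_eq', if_pos (Finset.mem_univ _)]
  -- Step D: the indicator at a line point is the line-position matrix entry
  have hD : ∀ (r : Fin d → Fin L) (s : Fin L), ind (cpt n L M b.1 + off n L M r + tstep (fine (L * n) M) b.2 (s : ℕ), b.2) = lineInd n L M r s b i := by
    intro r s
    rw [hind]
    simp only [lineInd, par_line_pt]
    by_cases hc : (r b.2 : ℕ) + (s : ℕ) < L
    · rw [if_pos hc, if_pos hc]
      by_cases hi : i = b
      · rw [if_pos hi, if_pos ⟨by rw [hi], by rw [hi]⟩]
      · rw [if_neg hi, if_neg]; rintro ⟨h1, h2⟩; exact hi (Prod.ext h1.symm h2.symm)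
    · rw [if_neg hc, if_neg hc]
      by_cases hi : i = (b.1 + unitVec (fine n M) b.2, b.2)
      · rw [if_pos hi, if_pos ⟨by rw [hi], by rw [hi]⟩]
      · rw [if_neg hi, if_neg]; rintro ⟨h1, h2⟩; exact hi (Prod.ext h1.symm h2.symm)
  -- assemble
  rw [Matrix.smul_apply, Matrix.mul_apply, Matrix.smul_apply, Matrix.sum_apply, smul_eq_mul, smul_eq_mul]
  simp_rw [hJ, Matrix.sum_apply]
  have hfac : ∀ z : Tor (fine (L * n) M) × Fin d, QstepFree n L M b z * (sq * (((L : ℂ) ^ d)⁻¹ * ind z)) = sq * ((L : ℂ) ^ d)⁻¹ * (QstepFree n L M b z * ind z) := by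
    intro z; ring
  simp_rw [hfac]
  rw [← Finset.mul_sum, hC]
  simp_rw [hD, ← Finset.mul_sum]
  rw [← mul_assoc, ← mul_assoc, show sq * (sq * ((L : ℂ) ^ d)⁻¹) = 1 by rw [← mul_assoc, hss, mul_inv_cancel₀ hLc], one_mul]

/-- the free averaging lifts: `√(L^d)·Q₁(1)·(J⊗1) = (√(L^d)·Q₁·J) ⊗ 1`. [folklore] -/
theorem sqrt_smul_Qstep_one_mul_JK_kron :
    (((Real.sqrt ((L : ℝ) ^ d)) : ℝ) : ℂ) • (Qstep n L M (fun _ _ _ _ => (1 : Matrix o o ℂ)) * (JK n L M ⊗ₖ (1 : Matrix o o ℂ)))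
      = ((((Real.sqrt ((L : ℝ) ^ d)) : ℝ) : ℂ) • (QstepFree n L M * JK n L M)) ⊗ₖ (1 : Matrix o o ℂ) := by
  rw [Qstep_one, ← kron_mul, Matrix.smul_kronecker]

/-! ## §3 The prolongation defect against `Δ_a⁻¹` -/

omit [NeZero L] in
/-- `‖Σ_{r,s} (D_{r,s} − 1)X‖ ≤ L^{d+1}·Σ_ν‖(S^ν − 1)X‖`: every `D_{r,s} − 1` is a row-restriction of `D − 1`. [folklore] -/
theorem opNorm_sum_lineInd_sub_one_mul_le {β : Type*} [Fintype β] [DecidableEq β] (X : Matrix (Tor (fine n M) × Fin d) β ℂ) :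
    ‖(∑ r : Fin d → Fin L, ∑ s : Fin L, (lineInd n L M r s - 1)) * X‖ ≤ (L : ℝ) ^ (d + 1) * ∑ ν : Fin d, ‖(shiftM (fine n M) ν - 1) * X‖ := by
  -- `D_{r,s} − 1 = P_{r,s}·(D − 1)` with `P_{r,s}` the 0/1 diagonal of the rows with `r_μ + s ≥ L`
  have hrs : ∀ (r : Fin d → Fin L) (s : Fin L), lineInd n L M r s - 1
      = Matrix.diagonal (fun b : Tor (fine n M) × Fin d => if (r b.2 : ℕ) + (s : ℕ) < L then (0 : ℂ) else 1) * (dshift (fine n M) - 1) := by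
    intro r s
    ext b i
    rw [Matrix.diagonal_mul, Matrix.sub_apply, Matrix.sub_apply, Matrix.one_apply]
    simp only [lineInd, dshift]
    by_cases hc : (r b.2 : ℕ) + (s : ℕ) < L
    · rw [if_pos hc, if_pos hc, zero_mul]
      by_cases hi : i = b
      · rw [if_pos hi, if_pos hi.symm, sub_self]
      · rw [if_neg hi, if_neg (Ne.symm hi), sub_self]
    · rw [if_neg hc, if_neg hc, one_mul]
  have hP : ∀ (r : Fin d → Fin L) (s : Fin L), ‖Matrix.diagonal (fun b : Tor (fine n M) × Fin d => if (r b.2 : ℕ) + (s : ℕ) < L then (0 : ℂ) else 1)‖ ≤ 1 := by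
    intro r s
    rw [Matrix.l2_opNorm_diagonal]
    refine (pi_norm_le_iff_of_nonneg zero_le_one).mpr fun b => ?_
    split_ifs <;> simp
  have hD := opNorm_dshift_sub_one_mul_le (fine n M) X
  rw [Matrix.sum_mul]
  calc ‖∑ r : Fin d → Fin L, (∑ s : Fin L, (lineInd n L M r s - 1)) * X‖
      ≤ ∑ r : Fin d → Fin L, ∑ s : Fin L, ∑ ν : Fin d, ‖(shiftM (fine n M) ν - 1) * X‖ := by
        refine (norm_sum_le _ _).trans (Finset.sum_le_sum fun r _ => ?_)
        rw [Matrix.sum_mul]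
        refine (norm_sum_le _ _).trans (Finset.sum_le_sum fun s _ => ?_)
        rw [hrs, Matrix.mul_assoc]
        calc _ ≤ ‖Matrix.diagonal (fun b : Tor (fine n M) × Fin d => if (r b.2 : ℕ) + (s : ℕ) < L then (0 : ℂ) else 1)‖ * ‖(dshift (fine n M) - 1) * X‖ := Matrix.l2_opNorm_mul _ _
          _ ≤ 1 * ‖(dshift (fine n M) - 1) * X‖ := mul_le_mul_of_nonneg_right (hP r s) (norm_nonneg _)
          _ ≤ ∑ ν : Fin d, ‖(shiftM (fine n M) ν - 1) * X‖ := by rw [one_mul]; exact hD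
    _ = (L : ℝ) ^ (d + 1) * ∑ ν : Fin d, ‖(shiftM (fine n M) ν - 1) * X‖ := by
        simp only [Finset.sum_const, Finset.card_univ, Fintype.card_fin, nsmul_eq_mul]
        rw [Fintype.card_fun, Fintype.card_fin, Fintype.card_fin]
        push_cast
        ring

/-- **THE ONE-STEP PROLONGATION DEFECT IS AN AVERAGE OF SHIFT DEFECTS**: `‖(√(L^d)·Q₁·J − 1)X‖ ≤ Σ_ν ‖(S^ν − 1)X‖` for any `X`. [folklore] -/
theorem opNorm_sqrt_QstepFree_JK_sub_one_mul_le {β : Type*} [Fintype β] [DecidableEq β] (X : Matrix (Tor (fine n M) × Fin d) β ℂ) :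
    ‖((((Real.sqrt ((L : ℝ) ^ d)) : ℝ) : ℂ) • (QstepFree n L M * JK n L M) - 1) * X‖ ≤ ∑ ν : Fin d, ‖(shiftM (fine n M) ν - 1) * X‖ := by
  have hL : (0 : ℝ) < (L : ℝ) ^ (d + 1) := pow_pos (by exact_mod_cast Nat.pos_of_ne_zero (NeZero.ne L)) _
  have hLc : ((L : ℂ) ^ (d + 1)) ≠ 0 := pow_ne_zero _ (by exact_mod_cast NeZero.ne L)
  have hw : ‖(1 / (L : ℂ) ^ (d + 1))‖ = ((L : ℝ) ^ (d + 1))⁻¹ := by rw [one_div, norm_inv, norm_pow, Complex.norm_natCast]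
  -- `√(L^d)Q₁J − 1 = L^{−(d+1)}·Σ_{r,s}(D_{r,s} − 1)` since there are `L^{d+1}` pairs
  have hcount : (∑ r : Fin d → Fin L, ∑ s : Fin L, (1 : Matrix (Tor (fine n M) × Fin d) (Tor (fine n M) × Fin d) ℂ)) = ((L : ℂ) ^ (d + 1)) • 1 := by
    rw [Finset.sum_const, Finset.card_univ, Finset.sum_const, Finset.card_univ, Fintype.card_fin, smul_smul, Fintype.card_fun, Fintype.card_fin,
      Fintype.card_fin, ← Nat.cast_smul_eq_nsmul ℂ]
    congr 1
    push_cast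
    ring
  have e : (((Real.sqrt ((L : ℝ) ^ d)) : ℝ) : ℂ) • (QstepFree n L M * JK n L M) - 1
      = (1 / (L : ℂ) ^ (d + 1)) • ∑ r : Fin d → Fin L, ∑ s : Fin L, (lineInd n L M r s - 1) := by
    rw [sqrt_smul_QstepFree_mul_JK]
    simp only [Finset.sum_sub_distrib]
    rw [hcount, smul_sub, smul_smul, one_div, inv_mul_cancel₀ hLc, one_smul]
  rw [e, Matrix.smul_mul, norm_smul, hw]
  calc ((L : ℝ) ^ (d + 1))⁻¹ * ‖(∑ r : Fin d → Fin L, ∑ s : Fin L, (lineInd n L M r s - 1)) * X‖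
      ≤ ((L : ℝ) ^ (d + 1))⁻¹ * ((L : ℝ) ^ (d + 1) * ∑ ν : Fin d, ‖(shiftM (fine n M) ν - 1) * X‖) :=
        mul_le_mul_of_nonneg_left (opNorm_sum_lineInd_sub_one_mul_le n L M X) (by positivity)
    _ = ∑ ν : Fin d, ‖(shiftM (fine n M) ν - 1) * X‖ := by field_simp

end Step

/-! ## §4 Along the tower: the defect against `Δ_{a,k}⁻¹` -/

section Tower

variable (L : ℕ) [NeZero L] (M : Fin d → ℕ) [hM : ∀ μ, NeZero (M μ)] {o : Type*} [Fintype o] [DecidableEq o] (a : ℝ) (ha : 0 < a)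

/-- **THE ONE-STEP PROLONGATION DEFECT AGAINST `Δ_a⁻¹`** ([B5] (1.89)'s axis defects `‖(S^ν − 1)𝒢‖ ≤ Cst/n_k`):
`‖(√(L^d)·Q₁·J_k − 1)·Δ_{a,k}⁻¹‖ ≤ d·Cst·(n_k)⁻¹`, `n_k = L^k`. [cite: Balaban1984PropagatorsI, Prop. 1.1 (1.89) p.33; King1986, Lemma 4.5 p.674 (method)] [folklore] -/
theorem opNorm_prolongation_defect_calG_le (k : ℕ) :
    ‖(haveI := lev_neZero L k; ((((Real.sqrt ((L : ℝ) ^ d)) : ℝ) : ℂ) • (QstepFree (lev L k) L M * JK (lev L k) L M) - 1)) * (calDalev L M a ha k)⁻¹‖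
      ≤ d * Cst d a / (lev L k : ℕ) := by
  haveI := lev_neZero L k
  have hn : (lev L k : ℂ) ≠ 0 := by exact_mod_cast NeZero.ne (lev L k)
  have hnn : ‖((lev L k : ℕ) : ℂ)‖ = (lev L k : ℕ) := by rw [Complex.norm_natCast]
  rw [calDalev_inv, calGlev]
  refine (opNorm_sqrt_QstepFree_JK_sub_one_mul_le (lev L k) L M _).trans ?_
  have hX : ∀ ν : Fin d, ‖(shiftM (fine (lev L k) M) ν - 1) * calG (lev L k) (one_le_lev' L k) M a ha‖ ≤ Cst d a / (lev L k : ℕ) := by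
    intro ν
    have h := opNorm_shiftM_sub_one_mul_le (calG (lev L k) (one_le_lev' L k) M a ha) hn ν (opNorm_fdiff_calG_le (lev L k) (one_le_lev' L k) M a ha ν)
    rwa [hnn] at h
  calc ∑ ν : Fin d, ‖(shiftM (fine (lev L k) M) ν - 1) * calG (lev L k) (one_le_lev' L k) M a ha‖ ≤ ∑ _ν : Fin d, Cst d a / (lev L k : ℕ) :=
        Finset.sum_le_sum fun ν _ => hX ν
    _ = d * Cst d a / (lev L k : ℕ) := by rw [Finset.sum_const, Finset.card_univ, Fintype.card_fin, nsmul_eq_mul]; ring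

/-- the same, colour-lifted: `‖(√(L^d)·Q₁(1)·(J_k⊗1) − 1)·(Δ_{a,k}⊗1)⁻¹‖ ≤ d·Cst·(n_k)⁻¹` (`J_k = JK (lev L k) L M = JpcT L M k`, `JpcT_eq_JK`). [folklore] -/
theorem opNorm_prolongation_defect_kron_le (k : ℕ) :
    ‖(haveI := lev_neZero L k; ((((Real.sqrt ((L : ℝ) ^ d)) : ℝ) : ℂ) • (Qstep (lev L k) L M (fun _ _ _ _ => (1 : Matrix o o ℂ)) * (JK (lev L k) L M ⊗ₖ (1 : Matrix o o ℂ))) - 1)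
        * ((calDalev L M a ha k)⁻¹ ⊗ₖ (1 : Matrix o o ℂ)))‖ ≤ d * Cst d a / (lev L k : ℕ) := by
  haveI := lev_neZero L k
  have e : ((((Real.sqrt ((L : ℝ) ^ d)) : ℝ) : ℂ) • (Qstep (lev L k) L M (fun _ _ _ _ => (1 : Matrix o o ℂ)) * (JK (lev L k) L M ⊗ₖ (1 : Matrix o o ℂ))) - 1)
        * ((calDalev L M a ha k)⁻¹ ⊗ₖ (1 : Matrix o o ℂ))
      = (((((Real.sqrt ((L : ℝ) ^ d)) : ℝ) : ℂ) • (QstepFree (lev L k) L M * JK (lev L k) L M) - 1) * (calDalev L M a ha k)⁻¹) ⊗ₖ (1 : Matrix o o ℂ) := by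
    rw [sqrt_smul_Qstep_one_mul_JK_kron, ← Matrix.one_kronecker_one (m := Tor (fine (lev L k) M) × Fin d) (n := o), ← sub_kronecker, ← kron_mul]
  rw [e]
  exact opNorm_kron_le_of_le o (opNorm_prolongation_defect_calG_le L M a ha k)

end Tower

end Summit.QuantumFields.BalabanUV.T4Continuum.NE2.OneStepProlongationDefect

end
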